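import Summits.ResolutionOfSingularities.ResolutionOfSingularities.Theorems.HomologicalConductorNoZenoMinimalityBaseChange
import Summits.ResolutionOfSingularities.ResolutionOfSingularities.Theorems.HomologicalConductorNoZenoSplitGaloisPackage
import HarnessLib

/-!
# Crux `NoZenoR` (stmt-ResolutionOfSingularities-19943), β layer, `stub_L1wCoreF` descent brick: **BC-4 FOR THE D2′ ONE-ROOT GERM**
# — the minimal desingularization of `D` base-changes to the minimal desingularization of `D_f`

Route `ResolutionOfSingularities/HomologicalConductor`, crux chain W4.4.  OURS (cell res-hironaka, seat res-L0-w44-stub-2;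
(L1)-PREP v4 §2 / planner (ρ43)/(ρ48)/DESK WORD 15 `seam3_descent` input); AI-written, weaker than expert review; nothing
here is a statement of the manuscript under review (Hironaka 2017).  Def-free, `--supports 19943 --as helper`.
CONDITIONAL on the route's Literature named facts Lipman 1969 (4.1), (16.1)(ii), (16.5), (27.3), (13.1) b), d)
(binders `h41 h161 h165 h273 h131b h131d`, all in `Sig.FactsW3`).

* **`isMinimalResolution_pullback_snd_germ`** — for a local, Noetherian, normal `k`-subalgebra `D ⊆ K` with
  `Frac D = K`, `dim D = 2` and a rational singularity, a monic `f ∈ D[X]` with irreducible separable reduction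
  (`K_f := K[X]/(f_K)` a field), and the MINIMAL desingularization `π : X → Spec D`: the base change
  `X ×_D Spec D_f → Spec D_f` to res-D-pv-039's one-root germ `D_f = locPrime (splitModel D f) (splitPrime D f)` is the
  MINIMAL desingularization of `Spec D_f` — `…NoZenoMinimalityBaseChange.isMinimalResolution_pullback_snd_of_tower`
  instantiated on res-D-pv-039's Galois splitting germ `…SplitGaloisPackage.exists_galoisGerm₂` and germ API
  (`isLocalHom_germ`, `flat_germ`, `isNoetherianRing_germ`, `map_maximalIdeal_germ`, `isSeparable_residueField_germ`,
  `ringKrullDim_germ`).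

References: J. Lipman, Publ. Math. IHÉS 36 (1969), Thm. (4.1), Lemma (16.1), Prop. (16.5), (27.3), Prop. (13.1)
[`Lipman1969`].
-/

noncomputable section

-- single-problem summit: the doubled namespace component `ResolutionOfSingularities` is forced
set_option linter.dupNamespace false

namespace Summit.ResolutionOfSingularities.ResolutionOfSingularities.Theorems.NoZeno.ExcCount

open CategoryTheory AlgebraicGeometry Limits IsLocalRing Polynomial
open Literature.AlgebraicGeometry.Resolution
open Summit.ResolutionOfSingularities.ResolutionOfSingularities.Theorems.NoZeno.SandwichCluster
open Parasite (locPrime isLocalRing_locPrime)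
open Summit.ResolutionOfSingularities.ResolutionOfSingularities.Theorems.NoZeno.SplittingBase

variable {k K : Type} [Field k] [Field K] [Algebra k K]

/-- **BC-4 for the D2′ one-root germ `D → D_f`.**  For `D ⊆ K` a local Noetherian normal `k`-subalgebra with
`Frac D = K`, `dim D = 2` and a rational singularity, `f ∈ D[X]` monic with irreducible separable reduction, and
`π : X → Spec D` the minimal desingularization, `X ×_D Spec D_f → Spec D_f` is the MINIMAL desingularization of the
one-root germ `D_f`.  (Galois ascent to res-D-pv-039's splitting germ `Ŝ`, then fpqc descent `Ŝ → D_f`; conditional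
on Lipman (4.1), (16.1)(ii), (16.5), (27.3), (13.1) b), d).)
[this work; cite: Lipman1969, Theorem (4.1) (p. 204), Lemma (16.1) (p. 231), Proposition (16.5) (p. 235)] -/
theorem isMinimalResolution_pullback_snd_germ
    (h41 : Lipman1969_4_1.{0}) (h161 : Lipman1969_16_1_ii.{0}) (h165 : Lipman1969_16_5.{0})
    (h273 : Lipman1969_27_3_rat.{0}) (h131b : Lipman1969_13_1_b_rat.{0}) (h131d : Lipman1969_13_1_d_rat.{0})
    (D : Subalgebra k K) [IsLocalRing ↥D] [IsNoetherianRing ↥D] [IsIntegrallyClosed ↥D] [IsFractionRing ↥D K]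
    (f : (↥D)[X]) [Fact (Irreducible (f.map (algebraMap ↥D K)))] (hf : f.Monic)
    (hirr : Irreducible (f.map (residue ↥D))) (hsep : (f.map (residue ↥D)).Separable)
    (hPf : (splitPrime D f).IsPrime) (h2 : ringKrullDim ↥D = 2) (hS : HasRationalSingularity ↥D)
    {X : Scheme.{0}} (π : X ⟶ Spec (.of ↥D)) (hπ : IsMinimalResolution π) :
    IsMinimalResolution (pullback.snd π (Spec.map (CommRingCat.ofHom
      (algebraMap ↥D ↥(locPrime (splitModel D f) (splitPrime D f) hPf))))) := by
  -- the one-root germ `D_f` over `D`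
  haveI := isLocalRing_locPrime (splitModel D f) (splitPrime D f) hPf
  haveI := isLocalHom_germ D f hf hirr hPf
  haveI := isNoetherianRing_germ D f hf hirr hPf
  haveI := flat_germ D f hf hirr hPf
  haveI := isSeparable_residueField_germ D f hf hirr hsep hPf
  have h2f : ringKrullDim ↥(locPrime (splitModel D f) (splitPrime D f) hPf) = 2 :=
    (ringKrullDim_germ D f hf hirr hsep hPf).trans h2
  -- res-D-pv-039's Galois splitting germ over it
  obtain ⟨Ŝ, _, _, _, _, _, _, B, _, _, _, _, 𝔫, _, _, _, _, _, _, _, _, H, _, _, ρ, hBunr, hBft, hmax, hmf', hfin,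
    hgal, hsepf, hdimB, hres⟩ := exists_galoisGerm₂ D f hf hirr hsep hPf
  haveI := hBunr
  haveI := hBft
  haveI := hfin
  haveI := hgal
  haveI := hsepf
  exact isMinimalResolution_pullback_snd_of_tower π 𝔫.primeCompl ρ hres h41 h161 h165 h273 h131b h131d h2 h2f
    (hdimB.trans h2) hS (map_maximalIdeal_germ D f hf hirr hPf) hmf' hmax hπ _ rfl

end Summit.ResolutionOfSingularities.ResolutionOfSingularities.Theorems.NoZeno.ExcCount

end
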